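import Mathlib
import Literature.MathematicalPhysics.QuantumFieldTheory.Balaban1983to89.B10Eq32AxialSuN

/-
Copyright: publication-cell `pub-balaban` (b2b), seat b2b-balaban-b10 gen 28 (v1).  Literature leaf — finite boxes of
`ℤ^d`, `SU(N) ⊂ M_N(ℂ)`, one-variable calculus along real rays, plaquette algebra in a C⋆-algebra, and one-line
applications of the cell's landed theorems only (`…B10Eq32AxialSuN` (gen 27) and, through it, `…B7Prop1Explicit`,
`…B7Prop1Local`, `…B7Prop2SpecialUnitary`, `…B10Eq26SiteGauge`, `…B10Eq27AxialLog`, `…B10Eq29TubeLine`,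
`…B10Eq31GlobalConj`, `…B10Eq61Leaves`, `…B10Eq61PerSite`, `…B13DerivZeroGauge`, `…B13Inv214Orbit`,
`…B13Inv214OrbitSUN`, `Literature.Analysis.Matrix.DetExp`, imported BY NAME, nothing edited); every theorem is
kernel-proved and tagged [folklore] or [cite: …] (a LOCATED printed shape); the objects are MODEL OBJECTS (functions of
finitely many matrix variables), never asserted to be Bałaban's; NO new cited facts, NO summit vocabulary.
-/

/-!
# `Balaban1983to89.B10Eq32RegularSuN` — [Balaban1985UV3] p. 264, *"(26) holds for all regular gauge field
# configurations"*: the `SU(N)` theorems (26) ⇒ (29), (31) ⇒ (32) of `…B10Eq32AxialSuN` RESTATED WITH THE GAUGE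
# INVARIANCE (26) ASSUMED ONLY ON THE SPACE OF REGULAR `SU(N)`-VALUED CONFIGURATIONS OF THE BOX (`SU(N)`-valued, all
# plaquette variables inside the box within `α′` of `1`), the hypothesis typed BY NAME as b13's relative orbit
# constancy `OrbitConstOnIn … (specialUnitaryUnits (Fin N)) … (regSU N lo hi α′)`

T. Bałaban, *Ultraviolet stability of three-dimensional lattice pure gauge field theories*, Commun. Math. Phys.
**102**, 255–275 (1985) [Balaban1985UV3] (cell paper B10; PDF `paper:balaban1985-cmp102-uv-stability-3d`, journal page
= PDF page + 254); T. Bałaban, *Averaging operations for lattice gauge theories*, Commun. Math. Phys. **98**, 17–51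
(1985) [Balaban1985Averaging] (cell paper B7 = B10's reference [4]; p. 24 and its (45): gauge covariance of closed
holonomies / gauge invariance of the plaquette deviations `|V(∂p) − 1|`).

CITATION HEADER (lean-in-tree rule).  The passages of B10 marked «p005», «p009», «p010» below were READ AS IMAGE for
this module from the renders `b2b-balaban-ref1/pages/1985-cmp102-uv-stability-3d/1985-cmp102-uv-stability-3d-pNNN-
x2.png`, NNN = 005 (journal p. 259: (12)–(13) and the paragraph after (17)), 009 (p. 263: (26) and the comment on it,
(27), (28), (29)), 010 (p. 264: (31), (32) and the paragraph around them); the passage of B7 marked «B7 p024» was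
read as image from `b2b-balaban-ref1/pages/1985-cmp98-averaging/1985-cmp98-averaging-p008-x2.png` (journal p. 24 =
PDF p. 8).
This module adds NO cited fact; the manuscript under audit is quoted for the SHAPES of definitions and hypotheses,
never cited for a disputed step.  Siblings used BY NAME (byte-identical, nothing edited; all reached through the one
import `…B10Eq32AxialSuN`): `…B7Prop1Explicit` (b07: `Site`, `e`, `e_apply`, `l1`, `axialFn`), `…B7Prop1Local` (b07:
`InBox`, `PlaqIn`, `inBox_of_between`, `add_e_apply`), `…B7Prop2SpecialUnitary` (b07: `specialUnitaryUnits`,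
`mem_specialUnitaryUnits`, `thetaN`, `ZU`, `val_ZU`, `ZU_mem`), `…B13Inv214Orbit` (b13: `Ends`, `gaugeAct`,
`gaugeAct_eq_star`, `smul_eq_gaugeAct`), `…B10Eq32SuN` (b10 gen 22: `mem_closure_span_suFlow_of_trace_eq_zero`),
`…B13Inv214OrbitSUN` (b13 gen 22: `OrbitConstOnIn`, `SiteGaugeInvSU`, `det_exp`, `differentiable_det`),
`…B13DerivZeroGauge` (b13: `apply_generator_eq_zero_of_comp_eq`), `…B10Eq29TubeLine` (b10: `cstarAlgebraMatrix`,
`Tube`, `TubeCfg`, `expLine`, `logHalfBound_expLine_of_derivZero`), `…B10Eq61PerSite` (b10: `DerivZeroAlongV`),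
`…B10Eq61Leaves` (b10: `expChart`, `differentiableAt_comp_expChart_zero`), `…B10Eq31GlobalConj` (b10: `conjCfg`,
`conjCfg_apply`, `adCfg`, `gaugeFlow`, `hasDerivAt_gaugeFlow`, `expChart_one_conjCfg`, `mem_closure_span_range_adCfg`),
`…B10Eq26SiteGauge` (b10 gen 25: `norm_le_one_of_mem_unitary`, `gaugeAct_const`, `eq29_of_gaugeFix`,
`diffAlongV_eq_sub`, `logHalfBound_congr`, `expLine_one_one`), `…B10Eq27AxialLog` (b10 gen 26: `latEnds`, `plaq`),
`…B10Eq32AxialSuN` (b10 gen 27: `BoxBond`, `boxEnds`, `extCfg`, `extCfg_coe`, `extCfg_of_not`, `extCfg_mem`,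
`gaugeAct_boxEnds`, `axialGenBox`, `axialGenBox_mem_skewAdjoint`, `norm_axialGenBox_le`, `axial_gaugeFix_box`,
`axialFn_mem_specialUnitaryGroup`, `trace_axialGenBox_eq_zero`, `hasDerivAt_comp_ofReal_smul`,
`exp_smul_mem_specialUnitaryGroup`, `conjCfg_eq_self_of_scalar`, `clm_eq_of_su_of_scalar`, `eq29_axialBox`,
`logHalfBound_sub_box_of_siteGaugeInvSU`).

WHY THIS MODULE (the open edge it closes, by name).  `…B10Eq32AxialSuN` (gen 27) proved the lineage's joint theorem
for `G = SU(N)` on a finite box, `logHalfBound_sub_box_of_siteGaugeInvSU`, under the hypothesis `h26 : ∀ X,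
SiteGaugeInvSU (boxEnds lo hi) (E X)` — (26) for all `SU(N)`-valued site transformations AT EVERY `SU(N)`-VALUED
CONFIGURATION of the box — and recorded in its HONEST SCOPE (v) that this OVER-COVERS the print, which has (26) on the
space of REGULAR configurations only («p010»: *"We have to notice only that (26) holds for all regular gauge field
configurations, not only for the minimal configurations U₁"*; the regular configurations are those passing the
characteristic functions `χ₁` of (13), «p005», whose restrictions `|V(∂p′) − 1| < 2L²g₀p(g₀)` are recalled before
(28), «p009»), while its proofs USE (26) only (i) at the gauge-fixed
configurations `φ ∈ sp′ X` (regular by the (13)-type hypothesis `h13`) to get (29), and (ii) along the real rays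
`t ↦ exp(t w)`, `w` `𝔰𝔲(N)`-valued, for `t` near `0` (configurations bondwise near `1`, hence regular) to get (31).
THIS MODULE makes that observation a theorem: it introduces the configuration SPACE `regSU N lo hi α′` (§4) — the one
new object — and restates (29), (31) ⇒ (32) and the joint theorem with `h26` REPLACED by b13's RELATIVE orbit
constancy `OrbitConstOnIn (boxEnds lo hi) (specialUnitaryUnits (Fin N)) (E X) (regSU N lo hi α′)` («(26) for the
`SU(N)`-valued site transformations, between configurations of the space `regSU`»; no competing (26)-predicate is
minted: b13's `OrbitConstOnIn` and b07's `specialUnitaryUnits` BY NAME, unfolded at value level in §5), with gen 27's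
global hypothesis shown to IMPLY the located one for every `α′` (§5) and gen 27's theorem recovered from the located
one as an `example` (§6).  The (31)-half is sharpened on the way (§1–§2, any finite carrier): invariance of `E X` under
`V ↦ W V W⋆`, `W ∈ SU(N)`, on the `SU(N)`-valued configurations within `δ` of `1` BONDWISE (any `δ > 0`) already gives
the `Ad(SU(N))`-invariance (31) of the derivative at `1`, because the derivative along a real ray only sees the ray
near `t = 0` (`HasDerivAt.congr_of_eventuallyEq`); and (31) ⇒ (32) is isolated as a theorem about the derivative
alone (`derivZeroAlongV_of_fderivConjInvariant`).  §7 records two toys: the tracelessness hypothesis `htr` cannot be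
dropped (the bond determinant), and — at the level of the bare (26)-predicates — the located hypothesis is STRICTLY
weaker than gen 27's global one on the unit square of `ℤ²` (a center-twisted configuration).

WHAT IS PRINTED (verbatim).
* B10 p. 259 («p005»): *"For g₀ sufficiently small 2L²g₀p(g₀) < a₁, where a₁ is the constant in Theorem 1 [7],
  hence there exists the exactly one critical configuration U₁ in a space of regular configurations satisfying the
  conditions in (12). Such a space contains the region of integration, so there is at most one critical point in the
  region."*; *"The configuration U₁ satisfies the regularity conditions |U₁(∂p) − 1| < 2B₃g₀p(g₀) on Ω₁"*; (13):
  *"χ₁ = ∏_{p′∈Ω₁⁽¹⁾} χ({|V(∂p′) − 1| < 2L²g₀p(g₀)}), χ′ = ∏_{b∈Ω₁} χ({|A′(b)| < 16·3²L²B₃g₀p(g₀)})"*.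
* B10 p. 263 («p009»): *"equalities hold 𝒫′₁(g₀, X, U₁ᵘ) = 𝒫′₁(g₀, X, U₁), (26) for all gauge transformations 𝓊."*;
  *"let us make a comment only on the gauge invariance (26). It follows from the invariance of the expressions in
  (13), if we make the simultaneous transformations U₁ → U₁ᵘ, A′ → R(𝓊)A′, we have to notice only that all the
  expansions and expressions introduced later preserve this property."*; *"The characteristic functions χ₁ defined
  in (13) give the restrictions |V(∂p′) − 1| < 2L²g₀p(g₀)"*; *"By the gauge invariance (26), we have 𝒫′₁(g₀, X, U₁) =
  𝒫′₁(g₀, X, exp i𝓗(B)), (29)"*.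
* B10 p. 264 («p010»): *"The gauge invariance (26) implies the invariance with respect to the global transformations
  R(U), U ∈ G, hence the equality R(U)((δ/δ𝓗(b))𝒫′₁)(g₀, X, 1) = ((δ/δ𝓗(b))𝒫′₁)(g₀, X, 1). (31) We have to notice
  only that (26) holds for all regular gauge field configurations, not only for the minimal configurations U₁. The
  derivative in the above formula is an element of the Lie algebra 𝔤, and by the assumption that 𝔤 is semi-simple,
  the only element invariant is 0, and we conclude ((δ/δ𝓗(b))𝒫′₁)(g₀, X, 1) = 0. (32) It is the only place we use
  the semi-simplicity, but the above conclusion is a fundamental point in our method."*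
* B7 p. 24 («B7 p024»): *"Indeed, for an arbitrary gauge field configuration U and a gauge transformation u, we have
  Uᵘ(Γ_{c,x})Uᵘ(c)⁻¹ = u(c₋)U(Γ_{c,x})U(c)⁻¹u⁻¹(c₋); thus the matrices Uᵘ(Γ_{c,x})Uᵘ(c)⁻¹ and U(Γ_{c,x})U(c)⁻¹
  are unitarily equivalent"*; (45): *"|V₀(∂p) − 1| = |V(∂p) − 1| < α₀"* (`V₀ = V^{v₀}`).

THE MATHEMATICS ([folklore]; four remarks).  (M1) RAYS ONLY NEAR `0`.  If `g` is (Fréchet-)differentiable at `0`,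
`T` is continuous linear, and `g(T(t•w)) = g(t•w)` for all real `t` in a neighbourhood of `0`, then `Dg(0)(T w) =
Dg(0)(w)`: both sides are the derivative at `0` of the same germ of a function of the real variable `t` (chain rule
along `t ↦ (t : ℂ)•w`, uniqueness of `HasDerivAt` under eventual equality).  For a finite carrier and any `w`,
`‖exp(t w_b) − 1‖ < δ` for all bonds `b` once `|t|` is small (continuity of `exp` at `0`).  (M2) (31) FROM THE REGULAR
CONFIGURATIONS.  Hence gen 27's real-slice argument (its (M3)) needs the conjugation invariance `E X(W V W⋆) = E X(V)`,
`W ∈ SU(N)`, only for the `SU(N)`-valued `V` with `‖V_b − 1‖ < δ` for all `b`: for `w` `𝔰𝔲(N)`-valued, `exp(t w_b) ∈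
SU(N)` and is `δ`-close to `1` for small `|t|`, so `g(Ad_W(t w)) = g(t w)` eventually, and (M1) gives `ℓ(Ad_W w) =
ℓ(w)` for the derivative `ℓ` of `E X ∘ exp-chart` at `0`; scalar tangents are `Ad`-fixed, and the bondwise
decomposition `M_N = 𝔰𝔲(N) ⊕ i𝔰𝔲(N) ⊕ ℂ·1` with ℂ-linearity extends `ℓ ∘ Ad_W = ℓ` to all tangent configurations
(gen 27's `clm_eq_of_su_of_scalar`) — (31).  (31) ⇒ (32) is then gen 27's: `ℓ` kills the derivatives at `t = 0` of
`t ↦ Ad_{exp(tA)} Z` (b13's `apply_generator_eq_zero_of_comp_eq`), whose closed span contains every TRACELESS-valued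
tangent configuration (`mem_closure_span_range_adCfg`), so the directional derivative of `E X` at `1` along a
traceless `w` — the `ζ`-derivative at `0` of `E X(exp-line)` — vanishes.  (M3) REGULARITY IS GAUGE INVARIANT AND HOLDS
NEAR `1`.  In a C⋆-algebra, for unitaries `U_b`: `‖U₁U₂U₃⋆U₄⋆ − 1‖ ≤ Σ‖U_b − 1‖` (telescoping, `‖U‖ ≤ 1`, `‖U⋆ − 1‖ =
‖U − 1‖`), so a configuration with `‖V_b − 1‖ ≤ δ` on all bonds has `‖V(∂p) − 1‖ ≤ 4δ` on all plaquettes; and for a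
site transformation `u` with unitary values the plaquette variable is CONJUGATED, `Vᵘ(∂p) = u(x)V(∂p)u(x)⋆` (the
inner factors `u(x + e_κ)⋆u(x + e_κ)` etc. cancel; «B7 p024»), so `‖Vᵘ(∂p) − 1‖ = ‖u(x)(V(∂p) − 1)u(x)⋆‖ = ‖V(∂p) −
1‖` (B7 (45)).  Consequently the space `regSU N lo hi α′ = {V : SU(N)-valued on the box bonds, ‖V(∂p) − 1‖ ≤ α′ for
the plaquettes p ⊂ Λ}` (plaquettes inside the box read only box bonds of the extension-by-`1`) is STABLE under the
`SU(N)`-valued site gauge action, contains `1` and every `SU(N)`-valued configuration bondwise within `α′/4` of `1`,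
and contains the gauge-fixed configurations `sp′ X` of the lineage (which are `SU(N)`-valued with `‖φ(∂p) − 1‖ ≤ α`
on the box plaquettes) as soon as `α ≤ α′`.  (M4) THE LOCATED (26) SUFFICES.  Relative orbit constancy on `regSU` —
`F(uVu⁻¹) = F(V)` whenever `u` is `SU(N)`-valued and BOTH `V` and `uVu⁻¹` lie in `regSU` — is, by the stability in
(M3), the same as `F(uVu⁻¹) = F(V)` for all `SU(N)`-valued `u` and all `V ∈ regSU`; in particular it holds at every
`φ ∈ sp′ X` (⇒ (29) by gen 25's `eq29_of_gaugeFix` with «admissible» = `SU(N)`-valued, the axial gauge `v₀` being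
`SU(N)`-valued by gen 27) and, with `u ≡ W` constant, at every `SU(N)`-valued `V` bondwise within `α′/4` of `1` (⇒ (31)
⇒ (32) by (M2) with `δ = α′/4 > 0`).  The rest of the joint theorem is gen 27's, binder by binder.

HYPOTHESIS SHAPES (never discharged here; each a LOCATED printed shape or a lineage binder BY NAME).  `h26` (located):
`∀ X, OrbitConstOnIn (boxEnds lo hi) (specialUnitaryUnits (Fin N)) (E X) (regSU N lo hi α′)` — «p009» (26) with
«p010» *"for all regular gauge field configurations"*, `α′` in the role of print's `2L²g₀p(g₀)` of (13); `hloc`,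
`hdep`, `hSU`, `h13` (with its `α`), `hR4`, `hRπ`, `hRpq`, `hsp`, `hE`, `hEb` — gen 27's binders verbatim (see the
HYPOTHESIS SHAPES of `…B10Eq32AxialSuN`); NEW scalar side conditions `0 < α′` and `α ≤ α′` (print: one and the same
constant `2L²g₀p(g₀) > 0` in (13) and in the sentence before (28)).

HONEST SCOPE.  (i) As in the whole lineage, `E`, `sp′`, the box, `α`, `α′` are MODEL OBJECTS: nothing here asserts
that Bałaban's `𝒫′₁(g₀, X, ·)` satisfies the hypotheses — the module proves «located (26) + localization + (13)-type
regularity + holomorphy + the input bound ⇒ the `LogHalfBound` for `E X φ − E X 1`», for `G = SU(N)` on a finite box.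
(ii) Print has ONE regularity constant (`2L²g₀p(g₀)` in (13) and before (28)); the module carries two, `α` (the
plaquette regularity of the gauge-fixed configurations, feeding (28)) and `α′` (the size of the space on which (26) is
assumed), with `α ≤ α′`, `0 < α′` — print's case is `α = α′`.  (iii) The space `regSU` is cut out by the PLAQUETTE
conditions `χ₁` of (13) only (with `≤ α′` for print's strict `< 2L²g₀p(g₀)`); the characteristic functions `χ′` of
(13) in the fluctuation variables `A′` and the representative `exp i𝓗(B)`, `𝓗(B) = HB + A₁` of (29) are not
modelled (the lineage's (29) is gen 25/26's axial-gauge representative `exp(iB_φ)`; see `…B10Eq32AxialSuN` HONEST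
SCOPE).  (iv) `G = SU(N)` concretely, `N ≥ 1` (`[NeZero N]`; the strictness toy has a non-empty range of `α′` only
for `N ≥ 2`); the `U(N)`-located analogue is not stated (gen 25's `U(N)` theorem has no (32)).  (v) The strictness
toy of §7 separates the two (26)-PREDICATES by a non-holomorphic test function; it does not (and cannot cheaply)
exhibit a HOLOMORPHIC `E` satisfying all the other binders of the joint theorem with the located but not the global
(26).  (vi) The carrier is a box of `ℤ^d`, not print's torus `T_η` (as in gen 26/27).

COLLISION MAP.  b13 (`…B13Inv214OrbitSUN`, gen 22): `OrbitConstOnIn`, `SiteGaugeInvSU`, `det_exp`,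
`differentiable_det` used BY NAME — the located (26) is an INSTANCE of b13's relative orbit constancy, no new
predicate; b07: `specialUnitaryUnits`, `InBox`, `PlaqIn`, `ZU` BY NAME — b07's (45) (`B7AvgGaugeCovariance
.norm_hol_gaugeAct_plaqWord`, units-level holonomies `hol`) is NOT restated: §3's covariance lemmas are for gen 26's
value-level `plaq` on `LSite d × Fin d → 𝔸` (different carrier and shape), tagged with the same printed source; b10
gen 25/26/27 BY NAME.  NEW here: `regSU` and its stability lemmas, the near-`1` forms of (31)/(32), the located joint
theorems, the toys.
-/

namespace Literature.MathematicalPhysics.QuantumFieldTheory.Balaban1983to89.B10Eq32RegularSuN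

open NormedSpace Set Metric Filter
open scoped Topology Matrix.Norms.L2Operator
open B7Prop1Explicit renaming Site → LSite
open B7Prop1Explicit (e l1 axialFn e_apply)
open B7Prop1Local (InBox PlaqIn inBox_of_between add_e_apply)
open B7Prop2SpecialUnitary (specialUnitaryUnits mem_specialUnitaryUnits thetaN ZU val_ZU ZU_mem)
open B13Inv214Orbit (Ends gaugeAct gaugeAct_eq_star Cfg smul_eq_gaugeAct isUnit_of_mem_unitary)
open B13Inv214OrbitSUN (OrbitConstOnIn SiteGaugeInvSU siteGaugeInvSU_det differentiable_det det_exp)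
open B13DerivZeroGauge (apply_generator_eq_zero_of_comp_eq)
open B10Eq29TubeLine (cstarAlgebraMatrix Tube TubeCfg expLine exp_ofReal_smul_mem_unitary
  logHalfBound_expLine_of_derivZero)
open B10Eq61Leaves (expChart differentiableAt_comp_expChart_zero)
open B10Eq61PerSite (DerivZeroAlongV)
open B10Eq31GlobalConj (commSpan conjCfg conjCfg_apply adCfg gaugeFlow hasDerivAt_gaugeFlow expChart_one_conjCfg
  star_exp_ofReal_smul mem_closure_span_range_adCfg)
open B10Eq26SiteGauge (norm_le_one_of_mem_unitary gaugeAct_const eq29_of_gaugeFix diffAlongV_eq_sub logHalfBound_congr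
  expLine_one_one)
open B10Eq27AxialLog (latEnds plaq unitCfg B27_eq_zero_dim_one U1_of_unitaryUnits unitCfg_mem_unitaryUnits)
open B10Eq32AxialSuN (BoxBond boxEnds extCfg extCfg_coe extCfg_of_not extCfg_mem gaugeAct_boxEnds axialGenBox
  axialGenBox_of_le axialGenBox_mem_skewAdjoint norm_axialGenBox_le axial_gaugeFix_box axialFn_mem_specialUnitaryGroup
  trace_axialGenBox_eq_zero hasDerivAt_comp_ofReal_smul exp_smul_mem_specialUnitaryGroup conjCfg_eq_self_of_scalar
  clm_eq_of_su_of_scalar logHalfBound_sub_box_of_siteGaugeInvSU eq29_axialBox)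
open _root_.Literature.Analysis.Matrix (det_exp_eq_exp_trace)

/-! ## §1. RAY INVARIANCE NEAR `0` SUFFICES FOR DERIVATIVE INVARIANCE ((M1); any normed spaces over `ℂ`) -/

section ray

variable {V F : Type*} [NormedAddCommGroup V] [NormedSpace ℂ V] [NormedAddCommGroup F] [NormedSpace ℂ F]

/-- **Ray invariance NEAR `0` ⇒ derivative invariance** (M1): if `g` is differentiable at `0`, `T` is continuous
linear and `g(T(t•w)) = g(t•w)` for all real `t` near `0`, then `Dg(0)(T w) = Dg(0) w` (chain rule along the real
ray, `HasDerivAt.congr_of_eventuallyEq`, uniqueness). [folklore] -/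
theorem fderiv_apply_eq_of_eventually_rayInvariant {g : V → F} (hg : DifferentiableAt ℂ g 0) (T : V →L[ℂ] V)
    {w : V} (h : ∀ᶠ t : ℝ in 𝓝 0, g (T ((t : ℂ) • w)) = g ((t : ℂ) • w)) :
    fderiv ℂ g 0 (T w) = fderiv ℂ g 0 w := by
  have h1 := hasDerivAt_comp_ofReal_smul hg (T w)
  have heq : (fun t : ℝ => g ((t : ℂ) • T w)) =ᶠ[𝓝 0] fun t : ℝ => g ((t : ℂ) • w) := by
    filter_upwards [h] with t ht
    rw [← map_smul]; exact ht
  exact (h1.congr_of_eventuallyEq heq.symm).unique (hasDerivAt_comp_ofReal_smul hg w)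

/-- Along a real ray through `0` in a product of normed algebras, the bondwise exponentials are eventually
`δ`-close to `1`. [folklore] -/
theorem eventually_norm_exp_smul_sub_one_lt {ι : Type*} [Finite ι] {𝔸 : Type*} [NormedRing 𝔸] [NormedAlgebra ℂ 𝔸]
    [CompleteSpace 𝔸] (w : ι → 𝔸) {δ : ℝ} (hδ : 0 < δ) :
    ∀ᶠ t : ℝ in 𝓝 0, ∀ b, ‖exp ((t : ℂ) • w b) - 1‖ < δ := by
  refine eventually_all.mpr fun b => ?_
  have h0 : ContinuousAt (fun t : ℝ => (t : ℂ) • w b) 0 :=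
    (Complex.continuous_ofReal.smul continuous_const).continuousAt
  have h1 : ContinuousAt (fun t : ℝ => exp ((t : ℂ) • w b)) 0 :=
    ((NormedSpace.exp_analytic (𝕂 := ℂ) _).continuousAt).comp h0
  have ht : Tendsto (fun t : ℝ => exp ((t : ℂ) • w b)) (𝓝 0) (𝓝 1) := by
    simpa using h1.tendsto
  filter_upwards [(Metric.tendsto_nhds.mp ht) δ hδ] with t ht'
  rwa [dist_eq_norm] at ht'

end ray

/-! ## §2. (31) AND (32) FROM (26) ON THE `SU(N)`-VALUED CONFIGURATIONS NEAR `1` ONLY ((M2); `𝔸 = M_N(ℂ)`, any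
## finite carrier `ι`) -/

section su

variable (N : ℕ)

attribute [local instance] B10Eq29TubeLine.cstarAlgebraMatrix

variable {ι : Type*} [Fintype ι] {D : LocDomainSys}

/-- **(31) FROM (26) ON THE `SU(N)`-VALUED CONFIGURATIONS `δ`-NEAR `1`** (M2): if `E X` is differentiable on a set
containing a tube and `E X(W V W⋆) = E X(V)` for `W ∈ SU(N)` and every `SU(N)`-VALUED `V` with `‖V_b − 1‖ < δ` on
all bonds (`δ > 0` arbitrary), then the derivative `ℓ` at `0` of `v ↦ E X(exp-chart v)` satisfies `ℓ ∘ Ad_W = ℓ` on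
ALL tangent configurations — gen 27's `fderiv_comp_conjCfg_eq_of_suInvariant` with the invariance hypothesis
restricted to a bondwise `δ`-neighbourhood of `1` (the real rays `t ↦ exp(t w)`, `w` `𝔰𝔲(N)`-valued, are
`SU(N)`-valued and eventually `δ`-close to `1`, §1). [cite: Balaban1985UV3, (31) p.264, p.264 («The gauge invariance
(26) implies the invariance with respect to the global transformations R(U), U ∈ G»)] -/
theorem fderiv_comp_conjCfg_eq_of_suInvariantNear [NeZero N] {E : D.Dom → (ι → Matrix (Fin N) (Fin N) ℂ) → ℂ}
    {sp : Set (ι → Matrix (Fin N) (Fin N) ℂ)} {a : ℝ} (ha : 0 < a) {X : D.Dom}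
    (hsp : TubeCfg ι (Matrix (Fin N) (Fin N) ℂ) a ⊆ sp) (hE : DifferentiableOn ℂ (E X) sp) {δ : ℝ} (hδ : 0 < δ)
    (hconj : ∀ W ∈ Matrix.specialUnitaryGroup (Fin N) ℂ, ∀ V : ι → Matrix (Fin N) (Fin N) ℂ,
      (∀ b, V b ∈ Matrix.specialUnitaryGroup (Fin N) ℂ) → (∀ b, ‖V b - 1‖ < δ) →
        E X (fun b => W * V b * star W) = E X V)
    {W : Matrix (Fin N) (Fin N) ℂ} (hW : W ∈ Matrix.specialUnitaryGroup (Fin N) ℂ) :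
    (fderiv ℂ (fun v => E X (expChart (D := D) (fun _ _ => (1 : Matrix (Fin N) (Fin N) ℂ)) X v)) 0).comp
        (conjCfg W (star W)) =
      fderiv ℂ (fun v => E X (expChart (D := D) (fun _ _ => (1 : Matrix (Fin N) (Fin N) ℂ)) X v)) 0 := by
  set g : (ι → Matrix (Fin N) (Fin N) ℂ) → ℂ :=
    fun v => E X (expChart (D := D) (fun _ _ => (1 : Matrix (Fin N) (Fin N) ℂ)) X v) with hg
  have hWu : W ∈ unitary (Matrix (Fin N) (Fin N) ℂ) := (Matrix.mem_specialUnitaryGroup_iff.mp hW).1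
  have h1 : W * star W = 1 := Unitary.mul_star_self_of_mem hWu
  have h2 : star W * W = 1 := Unitary.star_mul_self_of_mem hWu
  have hdiff : DifferentiableAt ℂ g 0 :=
    differentiableAt_comp_expChart_zero ha (fun _ => one_mem _) hsp hE
  refine clm_eq_of_su_of_scalar N _ _ (fun w hw => ?_) (fun w hw => ?_)
  · rw [ContinuousLinearMap.comp_apply]
    refine fderiv_apply_eq_of_eventually_rayInvariant hdiff _ ?_
    filter_upwards [eventually_norm_exp_smul_sub_one_lt w hδ] with t ht
    simp only [hg]
    rw [expChart_one_conjCfg h1 h2]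
    refine hconj W hW _ (fun b => ?_) (fun b => ?_)
    · simp only [expChart, Pi.smul_apply, mul_one]
      exact exp_smul_mem_specialUnitaryGroup N (hw b).1 (hw b).2 t
    · simp only [expChart, Pi.smul_apply, mul_one]
      exact ht b
  · rw [ContinuousLinearMap.comp_apply, conjCfg_eq_self_of_scalar N hWu hw]

/-- **(31) ⇒ (32)** as a theorem about the derivative alone: if for every `X` the derivative `ℓ_X` at `0` of `v ↦ E
X(exp-chart v)` is `Ad(SU(N))`-invariant (`ℓ_X ∘ Ad_W = ℓ_X`, `W ∈ SU(N)`) and the generator is TRACELESS-valued on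
`sp′ X`, then `d/dζ E X(exp-line)|_{ζ=0} = 0` (`DerivZeroAlongV`): `ℓ_X` kills `d/dt Ad_{exp(tS)} w|₀ = ad_S w` for
`S ∈ 𝔰𝔲(N)` (b13's `apply_generator_eq_zero_of_comp_eq`), hence the closed span of these, which contains every
traceless-valued tangent configuration (gen 22's `mem_closure_span_suFlow_of_trace_eq_zero`, b10's
`mem_closure_span_range_adCfg`) — the second half of gen 27's `derivZeroAlongV_of_suInvariant`, isolated.
[cite: Balaban1985UV3, (31)–(32) p.264, p.264 («by the assumption that 𝔤 is semi-simple, the only element invariant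
is 0»)] -/
theorem derivZeroAlongV_of_fderivConjInvariant [NeZero N] {E : D.Dom → (ι → Matrix (Fin N) (Fin N) ℂ) → ℂ}
    {sp sp' : D.Dom → Set (ι → Matrix (Fin N) (Fin N) ℂ)}
    {gen : D.Dom → (ι → Matrix (Fin N) (Fin N) ℂ) → ι → Matrix (Fin N) (Fin N) ℂ} {a : ℝ} (ha : 0 < a)
    (hsp : ∀ X, TubeCfg ι (Matrix (Fin N) (Fin N) ℂ) a ⊆ sp X) (hE : ∀ X, DifferentiableOn ℂ (E X) (sp X))
    (h31 : ∀ X, ∀ W ∈ Matrix.specialUnitaryGroup (Fin N) ℂ,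
      (fderiv ℂ (fun v => E X (expChart (D := D) (fun _ _ => (1 : Matrix (Fin N) (Fin N) ℂ)) X v)) 0).comp
          (conjCfg W (star W)) =
        fderiv ℂ (fun v => E X (expChart (D := D) (fun _ _ => (1 : Matrix (Fin N) (Fin N) ℂ)) X v)) 0)
    (htr : ∀ X φ, φ ∈ sp' X → ∀ b, Matrix.trace (gen X φ b) = 0) :
    DerivZeroAlongV sp' E (expLine gen (fun _ _ _ => 1)) := by
  intro X φ hφ
  have hdiff : DifferentiableAt ℂ
      (fun v => E X (expChart (D := D) (fun _ _ => (1 : Matrix (Fin N) (Fin N) ℂ)) X v)) 0 :=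
    differentiableAt_comp_expChart_zero ha (fun _ => one_mem _) (hsp X) (hE X)
  set ℓ := fderiv ℂ (fun v => E X (expChart (D := D) (fun _ _ => (1 : Matrix (Fin N) (Fin N) ℂ)) X v)) 0 with hℓ
  have had : ∀ (l : {S : Matrix (Fin N) (Fin N) ℂ // star S = -S ∧ Matrix.trace S = 0})
      (w : ι → Matrix (Fin N) (Fin N) ℂ), ℓ (adCfg (l : Matrix (Fin N) (Fin N) ℂ) w) = 0 := by
    rintro ⟨S, hS, hS0⟩ w
    refine apply_generator_eq_zero_of_comp_eq ℓ (hasDerivAt_gaugeFlow S w) (Eventually.of_forall fun t => ?_)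
    have hW := exp_smul_mem_specialUnitaryGroup N hS hS0 t
    have hflow : gaugeFlow S t w = conjCfg (exp ((t : ℂ) • S)) (star (exp ((t : ℂ) • S))) w := by
      rw [star_exp_ofReal_smul (skewAdjoint.mem_iff.mpr hS) t]; rfl
    rw [hflow, ← ContinuousLinearMap.comp_apply, hℓ, h31 X _ hW]
  have hle : Submodule.span ℂ (⋃ l : {S : Matrix (Fin N) (Fin N) ℂ // star S = -S ∧ Matrix.trace S = 0},
      Set.range (adCfg (ι := ι) (l : Matrix (Fin N) (Fin N) ℂ))) ≤ LinearMap.ker ℓ.toLinearMap := by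
    refine Submodule.span_le.mpr fun v hv => ?_
    obtain ⟨l, hl⟩ := Set.mem_iUnion.mp hv
    obtain ⟨w, rfl⟩ := hl
    exact had l w
  have hker := closure_minimal (t := {v : ι → Matrix (Fin N) (Fin N) ℂ | ℓ v = 0}) (fun v hv => hle hv)
    (isClosed_eq ℓ.continuous continuous_const)
  have hmem := mem_closure_span_range_adCfg
    (fun l : {S : Matrix (Fin N) (Fin N) ℂ // star S = -S ∧ Matrix.trace S = 0} => (l : Matrix (Fin N) (Fin N) ℂ))
    (B10Eq32SuN.mem_closure_span_suFlow_of_trace_eq_zero N htr X φ hφ)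
  have hℓgen : ℓ (gen X φ) = 0 := hker hmem
  have hγ : HasDerivAt (fun ζ : ℂ => ζ • gen X φ) (gen X φ) 0 := by
    simpa using (hasDerivAt_id (0 : ℂ)).smul_const (gen X φ)
  have hf : HasFDerivAt (fun v => E X (expChart (D := D) (fun _ _ => (1 : Matrix (Fin N) (Fin N) ℂ)) X v)) ℓ
      ((fun ζ : ℂ => ζ • gen X φ) 0) := by
    simpa only [zero_smul] using hdiff.hasFDerivAt
  have hc : HasDerivAt ((fun v => E X (expChart (D := D) (fun _ _ => (1 : Matrix (Fin N) (Fin N) ℂ)) X v)) ∘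
      fun ζ : ℂ => ζ • gen X φ) (ℓ (gen X φ)) 0 := hf.comp_hasDerivAt (0 : ℂ) hγ
  have heq : (fun ζ => E X (expLine gen (fun _ _ _ => 1) X φ ζ)) =
      ((fun v => E X (expChart (D := D) (fun _ _ => (1 : Matrix (Fin N) (Fin N) ℂ)) X v)) ∘
        fun ζ : ℂ => ζ • gen X φ) := rfl
  rw [heq, hc.deriv, hℓgen]

/-- **(32) FROM (26) ON THE `SU(N)`-VALUED CONFIGURATIONS `δ`-NEAR `1`**: the two previous theorems composed — gen
27's `derivZeroAlongV_of_suInvariant` with `hconj` restricted to a bondwise `δ`-neighbourhood of `1`, `δ > 0`.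
[cite: Balaban1985UV3, (31)–(32) p.264, p.264 («(26) holds for all regular gauge field configurations»)] -/
theorem derivZeroAlongV_of_suInvariantNear [NeZero N] {E : D.Dom → (ι → Matrix (Fin N) (Fin N) ℂ) → ℂ}
    {sp sp' : D.Dom → Set (ι → Matrix (Fin N) (Fin N) ℂ)}
    {gen : D.Dom → (ι → Matrix (Fin N) (Fin N) ℂ) → ι → Matrix (Fin N) (Fin N) ℂ} {a : ℝ} (ha : 0 < a)
    (hsp : ∀ X, TubeCfg ι (Matrix (Fin N) (Fin N) ℂ) a ⊆ sp X) (hE : ∀ X, DifferentiableOn ℂ (E X) (sp X))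
    {δ : ℝ} (hδ : 0 < δ)
    (hconj : ∀ X, ∀ W ∈ Matrix.specialUnitaryGroup (Fin N) ℂ, ∀ V : ι → Matrix (Fin N) (Fin N) ℂ,
      (∀ b, V b ∈ Matrix.specialUnitaryGroup (Fin N) ℂ) → (∀ b, ‖V b - 1‖ < δ) →
        E X (fun b => W * V b * star W) = E X V)
    (htr : ∀ X φ, φ ∈ sp' X → ∀ b, Matrix.trace (gen X φ b) = 0) :
    DerivZeroAlongV sp' E (expLine gen (fun _ _ _ => 1)) :=
  derivZeroAlongV_of_fderivConjInvariant N ha hsp hE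
    (fun X _ hW => fderiv_comp_conjCfg_eq_of_suInvariantNear N ha (hsp X) (hE X) hδ (hconj X) hW) htr

/-- Sanity: gen 27's `derivZeroAlongV_of_suInvariant` (invariance at ALL `SU(N)`-valued configurations) is the case
«`δ = 1`, closeness hypothesis ignored». [folklore] -/
example [NeZero N] {E : D.Dom → (ι → Matrix (Fin N) (Fin N) ℂ) → ℂ}
    {sp sp' : D.Dom → Set (ι → Matrix (Fin N) (Fin N) ℂ)}
    {gen : D.Dom → (ι → Matrix (Fin N) (Fin N) ℂ) → ι → Matrix (Fin N) (Fin N) ℂ} {a : ℝ} (ha : 0 < a)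
    (hsp : ∀ X, TubeCfg ι (Matrix (Fin N) (Fin N) ℂ) a ⊆ sp X) (hE : ∀ X, DifferentiableOn ℂ (E X) (sp X))
    (hconj : ∀ X, ∀ W ∈ Matrix.specialUnitaryGroup (Fin N) ℂ, ∀ V : ι → Matrix (Fin N) (Fin N) ℂ,
      (∀ b, V b ∈ Matrix.specialUnitaryGroup (Fin N) ℂ) → E X (fun b => W * V b * star W) = E X V)
    (htr : ∀ X φ, φ ∈ sp' X → ∀ b, Matrix.trace (gen X φ b) = 0) :
    DerivZeroAlongV sp' E (expLine gen (fun _ _ _ => 1)) :=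
  derivZeroAlongV_of_suInvariantNear N ha hsp hE one_pos (fun X W' hW V hV _ => hconj X W' hW V hV) htr

end su

/-! ## §3. PLAQUETTE ALGEBRA IN A C⋆-ALGEBRA ((M3); gen 26's value-level `plaq` on `ℤ^d`) -/

section plaquette

variable {d : ℕ} {𝔸 : Type*} [CStarAlgebra 𝔸]

/-- `‖U⋆ − 1‖ = ‖U − 1‖`. [folklore] -/
theorem norm_star_sub_one (U : 𝔸) : ‖star U - 1‖ = ‖U - 1‖ := by
  rw [← norm_star (U - 1), star_sub, star_one]

/-- Telescoping: `‖ABCD − 1‖ ≤ ‖A − 1‖ + ‖B − 1‖ + ‖C − 1‖ + ‖D − 1‖` for `B`, `C`, `D` unitary (`ABCD − 1 =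
(A − 1)BCD + (B − 1)CD + (C − 1)D + (D − 1)` and right multiplication by a unitary is isometric). [folklore] -/
theorem norm_mul_mul_mul_sub_one_le {A B C D : 𝔸} (hB : B ∈ unitary 𝔸) (hC : C ∈ unitary 𝔸)
    (hD : D ∈ unitary 𝔸) : ‖A * B * C * D - 1‖ ≤ ‖A - 1‖ + ‖B - 1‖ + ‖C - 1‖ + ‖D - 1‖ := by
  have h : A * B * C * D - 1 = (A - 1) * (B * C * D) + (B - 1) * (C * D) + (C - 1) * D + (D - 1) := by
    noncomm_ring
  rw [h]
  have h1 : ‖(A - 1) * (B * C * D)‖ = ‖A - 1‖ :=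
    CStarRing.norm_mul_mem_unitary _ (mul_mem (mul_mem hB hC) hD)
  have h2 : ‖(B - 1) * (C * D)‖ = ‖B - 1‖ := CStarRing.norm_mul_mem_unitary _ (mul_mem hC hD)
  have h3 : ‖(C - 1) * D‖ = ‖C - 1‖ := CStarRing.norm_mul_mem_unitary _ hD
  calc ‖(A - 1) * (B * C * D) + (B - 1) * (C * D) + (C - 1) * D + (D - 1)‖
      ≤ ‖(A - 1) * (B * C * D)‖ + ‖(B - 1) * (C * D)‖ + ‖(C - 1) * D‖ + ‖D - 1‖ :=
        (norm_add_le _ _).trans (by gcongr; exact (norm_add_le _ _).trans (by gcongr; exact norm_add_le _ _))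
    _ = ‖A - 1‖ + ‖B - 1‖ + ‖C - 1‖ + ‖D - 1‖ := by rw [h1, h2, h3]

/-- **Plaquette variables of bondwise near-`1` configurations are near `1`**: for unitary-valued `φ`,
`‖V(∂p) − 1‖ ≤` the sum of the four `‖φ_b − 1‖`, `b ⊂ ∂p`. [folklore] -/
theorem norm_plaq_sub_one_le {φ : LSite d × Fin d → 𝔸} (hφ : ∀ b, φ b ∈ unitary 𝔸) (x : LSite d) (κ μ : Fin d) :
    ‖plaq φ x κ μ - 1‖ ≤
      ‖φ (x, κ) - 1‖ + ‖φ (x + e κ, μ) - 1‖ + ‖φ (x + e μ, κ) - 1‖ + ‖φ (x, μ) - 1‖ := by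
  have h := norm_mul_mul_mul_sub_one_le (A := φ (x, κ)) (hφ (x + e κ, μ)) (Unitary.star_mem (hφ (x + e μ, κ)))
    (Unitary.star_mem (hφ (x, μ)))
  rwa [norm_star_sub_one, norm_star_sub_one] at h

/-- **Gauge covariance of the plaquette variables**: `Vᵘ(∂p) = u(x)·V(∂p)·u(x)⋆` for unitary-valued `u` (`p` the
plaquette at `x`; the inner factors `u(·)⋆u(·)` cancel). [cite: Balaban1985Averaging, p.24 («thus the matrices
Uᵘ(Γ_{c,x})Uᵘ(c)⁻¹ and U(Γ_{c,x})U(c)⁻¹ are unitarily equivalent»), (45) p.24] -/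
theorem plaq_gaugeAct {u : LSite d → 𝔸} (hu : ∀ x, u x ∈ unitary 𝔸) (φ : LSite d × Fin d → 𝔸) (x : LSite d)
    (κ μ : Fin d) : plaq (gaugeAct (latEnds d) u φ) x κ μ = u x * plaq φ x κ μ * star (u x) := by
  rw [gaugeAct_eq_star _ hu]
  have hc : x + e κ + e μ = x + e μ + e κ := add_right_comm _ _ _
  simp only [plaq, latEnds, star_mul, star_star, hc, mul_assoc]
  congr 2
  rw [← mul_assoc (star (u (x + e κ))), Unitary.star_mul_self_of_mem (hu _), one_mul]
  congr 1
  rw [← mul_assoc (star (u (x + e μ + e κ))), Unitary.star_mul_self_of_mem (hu _), one_mul]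
  congr 1
  rw [← mul_assoc (star (u (x + e μ))), Unitary.star_mul_self_of_mem (hu _), one_mul]

/-- … hence `‖Vᵘ(∂p) − 1‖ = ‖V(∂p) − 1‖` — B7's (45) «|V₀(∂p) − 1| = |V(∂p) − 1|», here for every unitary-valued
site transformation. [cite: Balaban1985Averaging, (45) p.24] -/
theorem norm_plaq_gaugeAct_sub_one {u : LSite d → 𝔸} (hu : ∀ x, u x ∈ unitary 𝔸) (φ : LSite d × Fin d → 𝔸)
    (x : LSite d) (κ μ : Fin d) : ‖plaq (gaugeAct (latEnds d) u φ) x κ μ - 1‖ = ‖plaq φ x κ μ - 1‖ := by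
  rw [plaq_gaugeAct hu]
  have h : u x * plaq φ x κ μ * star (u x) - 1 = u x * (plaq φ x κ μ - 1) * star (u x) := by
    rw [mul_sub, sub_mul, mul_one, Unitary.mul_star_self_of_mem (hu x)]
  rw [h, CStarRing.norm_mul_mem_unitary _ (Unitary.star_mem (hu x)), CStarRing.norm_mem_unitary_mul _ (hu x)]

/-- The four bonds of a plaquette inside the box are box bonds. [folklore] -/
theorem plaqIn_bonds {lo hi x : LSite d} {κ μ : Fin d} (h : PlaqIn lo hi (x, κ, μ)) :
    (InBox lo hi x ∧ InBox lo hi (x + e κ)) ∧ (InBox lo hi (x + e κ) ∧ InBox lo hi (x + e κ + e μ)) ∧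
      (InBox lo hi (x + e μ) ∧ InBox lo hi (x + e μ + e κ)) ∧ (InBox lo hi x ∧ InBox lo hi (x + e μ)) := by
  obtain ⟨hx, hxy⟩ := h
  have hk : InBox lo hi (x + e κ) := inBox_of_between hx hxy fun i => by
    simp only [add_e_apply]; split_ifs <;> omega
  have hm : InBox lo hi (x + e μ) := inBox_of_between hx hxy fun i => by
    simp only [add_e_apply]; split_ifs <;> omega
  have hc : x + e μ + e κ = x + e κ + e μ := add_right_comm _ _ _
  exact ⟨⟨hx, hk⟩, ⟨hk, hxy⟩, ⟨hm, hc ▸ hxy⟩, ⟨hx, hm⟩⟩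

/-- A plaquette variable inside the box reads only box bonds: for a plaquette `p ⊂ Λ`, the plaquette variable of the
extension of `V^u` (action on the box carrier) is that of `(extension of V)^u` (action on `ℤ^d`). [folklore] -/
theorem plaq_extCfg_gaugeAct {lo hi : LSite d} (u : LSite d → 𝔸) (V : BoxBond lo hi → 𝔸) {x : LSite d}
    {κ μ : Fin d} (h : PlaqIn lo hi (x, κ, μ)) :
    plaq (extCfg lo hi (gaugeAct (boxEnds lo hi) u V)) x κ μ =
      plaq (gaugeAct (latEnds d) u (extCfg lo hi V)) x κ μ := by
  obtain ⟨h1, h2, h3, h4⟩ := plaqIn_bonds h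
  have key : ∀ {b : LSite d × Fin d} (hb : InBox lo hi b.1 ∧ InBox lo hi (b.1 + e b.2)),
      extCfg lo hi (gaugeAct (boxEnds lo hi) u V) b = gaugeAct (latEnds d) u (extCfg lo hi V) b := by
    intro b hb
    have h := extCfg_coe (gaugeAct (boxEnds lo hi) u V) ⟨b, hb⟩
    rw [gaugeAct_boxEnds] at h
    exact h
  simp only [plaq]
  rw [key (b := (x, κ)) h1, key (b := (x + e κ, μ)) h2, key (b := (x + e μ, κ)) h3, key (b := (x, μ)) h4]

end plaquette

/-! ## §4. THE SPACE `regSU N lo hi α′` OF REGULAR `SU(N)`-VALUED CONFIGURATIONS OF THE BOX: stable under the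
## `SU(N)`-valued site gauge action, contains `1` and everything bondwise within `α′/4` of `1` ((M3)) -/

section regular

variable (N : ℕ) {d : ℕ}

attribute [local instance] B10Eq29TubeLine.cstarAlgebraMatrix

/-- `M_N(ℂ)`. -/
local notation "M[" N "]" => Matrix (Fin N) (Fin N) ℂ

/-- **THE SPACE OF REGULAR `SU(N)`-VALUED CONFIGURATIONS OF THE BOX `Λ = Π[lo, hi]`**: `V` is `SU(N)`-valued on
the box bonds and every plaquette `p ⊂ Λ` (b07's `PlaqIn`, genuinely two-dimensional: `κ ≠ μ`) has its plaquette
variable (gen 26's `plaq` of the extension-by-`1`, which reads only box bonds, §3) within `α′` of `1` — the space cut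
out by the characteristic functions `χ₁` of (13) (print: strict `<`, constant `2L²g₀p(g₀)`; here `≤ α′`), on which
«p010» says (26) holds. [cite: Balaban1985UV3, (13) p.259 («χ({|V(∂p′) − 1| < 2L²g₀p(g₀)})»), p.264 («for all
regular gauge field configurations»)] -/
def regSU (lo hi : LSite d) (α' : ℝ) : Set (BoxBond lo hi → M[N]) :=
  {V | (∀ b, V b ∈ Matrix.specialUnitaryGroup (Fin N) ℂ) ∧
    ∀ (x : LSite d) (κ μ : Fin d), κ ≠ μ → PlaqIn lo hi (x, κ, μ) → ‖plaq (extCfg lo hi V) x κ μ - 1‖ ≤ α'}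

variable {N}

/-- Unfolding. [folklore] -/
theorem mem_regSU {lo hi : LSite d} {α' : ℝ} {V : BoxBond lo hi → M[N]} :
    V ∈ regSU N lo hi α' ↔ (∀ b, V b ∈ Matrix.specialUnitaryGroup (Fin N) ℂ) ∧
      ∀ (x : LSite d) (κ μ : Fin d), κ ≠ μ → PlaqIn lo hi (x, κ, μ) → ‖plaq (extCfg lo hi V) x κ μ - 1‖ ≤ α' :=
  Iff.rfl

/-- `star W ∈ SU(N)` for `W ∈ SU(N)`. [folklore] -/
theorem star_mem_specialUnitaryGroup {W : M[N]} (hW : W ∈ Matrix.specialUnitaryGroup (Fin N) ℂ) :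
    star W ∈ Matrix.specialUnitaryGroup (Fin N) ℂ :=
  (star (⟨W, hW⟩ : Matrix.specialUnitaryGroup (Fin N) ℂ)).2

/-- `SU(N)`-valued transformations preserve `SU(N)`-valued configurations. [folklore] -/
theorem gaugeAct_mem_specialUnitaryGroup {ι S : Type*} (γ : Ends ι S) {u : S → M[N]}
    (hu : ∀ x, u x ∈ Matrix.specialUnitaryGroup (Fin N) ℂ) {V : ι → M[N]}
    (hV : ∀ b, V b ∈ Matrix.specialUnitaryGroup (Fin N) ℂ) (b : ι) :
    gaugeAct γ u V b ∈ Matrix.specialUnitaryGroup (Fin N) ℂ := by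
  rw [gaugeAct_eq_star γ fun x => (Matrix.mem_specialUnitaryGroup_iff.mp (hu x)).1]
  exact mul_mem (mul_mem (hu _) (hV b)) (star_mem_specialUnitaryGroup (hu _))

/-- The flat configuration `V ≡ 1` is regular (`α' ≥ 0`). [folklore] -/
theorem one_mem_regSU {lo hi : LSite d} {α' : ℝ} (hα' : 0 ≤ α') : (fun _ => (1 : M[N])) ∈ regSU N lo hi α' := by
  refine ⟨fun _ => one_mem _, fun x κ μ _ _ => ?_⟩
  have h1 : ∀ b, extCfg lo hi (fun _ : BoxBond lo hi => (1 : M[N])) b = 1 := fun b => by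
    unfold extCfg; split_ifs <;> rfl
  simp only [plaq, h1, star_one, mul_one, sub_self, norm_zero]
  exact hα'

/-- **`SU(N)`-valued gauge transformations preserve regularity** (plaquette variables are gauge COVARIANT,
`‖V^u(∂p) − 1‖ = ‖V(∂p) − 1‖`). [cite: Balaban1985Averaging, (45) p.24] -/
theorem gaugeAct_mem_regSU {lo hi : LSite d} {α' : ℝ} {u : LSite d → M[N]}
    (hu : ∀ x, u x ∈ Matrix.specialUnitaryGroup (Fin N) ℂ) {V : BoxBond lo hi → M[N]} (hV : V ∈ regSU N lo hi α') :
    gaugeAct (boxEnds lo hi) u V ∈ regSU N lo hi α' := by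
  have hu' : ∀ x, u x ∈ unitary M[N] := fun x => (Matrix.mem_specialUnitaryGroup_iff.mp (hu x)).1
  refine ⟨gaugeAct_mem_specialUnitaryGroup (boxEnds lo hi) hu hV.1, fun x κ μ hne hp => ?_⟩
  rw [plaq_extCfg_gaugeAct u V hp, norm_plaq_gaugeAct_sub_one hu']
  exact hV.2 x κ μ hne hp

/-- **Bondwise near-`1` ⇒ regular**: an `SU(N)`-valued configuration of the box with all `‖V_b − 1‖ ≤ δ`,
`4δ ≤ α'`, is regular. [folklore] -/
theorem mem_regSU_of_norm_sub_one_le {lo hi : LSite d} {α' δ : ℝ} (hδ0 : 0 ≤ δ) (h4 : 4 * δ ≤ α')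
    {V : BoxBond lo hi → M[N]} (hV : ∀ b, V b ∈ Matrix.specialUnitaryGroup (Fin N) ℂ) (hδ : ∀ b, ‖V b - 1‖ ≤ δ) :
    V ∈ regSU N lo hi α' := by
  have hU : ∀ b, extCfg lo hi V b ∈ unitary M[N] :=
    extCfg_mem fun b => (Matrix.mem_specialUnitaryGroup_iff.mp (hV b)).1
  have hb : ∀ b, ‖extCfg lo hi V b - 1‖ ≤ δ := fun b => by
    by_cases h : InBox lo hi b.1 ∧ InBox lo hi (b.1 + e b.2)
    · have h' := hδ ⟨b, h⟩
      rw [← extCfg_coe V ⟨b, h⟩] at h'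
      exact h'
    · rw [extCfg_of_not V h, sub_self, norm_zero]; exact hδ0
  refine ⟨hV, fun x κ μ _ _ => (norm_plaq_sub_one_le hU x κ μ).trans ?_⟩
  linarith [hb (x, κ), hb (x + e κ, μ), hb (x + e μ, κ), hb (x, μ)]

end regular


/-! ## §5. (26) ON THE REGULAR CONFIGURATIONS, BY NAME: b13's `OrbitConstOnIn` with `H = SU(N)` (b07's
## `specialUnitaryUnits`) and `𝒮 = regSU` -/

section located

variable {N : ℕ} {d : ℕ}

attribute [local instance] B10Eq29TubeLine.cstarAlgebraMatrix

/-- `M_N(ℂ)`. -/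
local notation "M[" N "]" => Matrix (Fin N) (Fin N) ℂ

/-- **UNFOLDING b13's RELATIVE ORBIT CONSTANCY FOR `H = SU(N)`** at value level: `OrbitConstOnIn γ SU(N) F 𝒮` says
`F(𝐕ᵘ) = F(𝐕)` for every `SU(N)`-valued `u` and every `𝐕 ∈ 𝒮` with `𝐕ᵘ ∈ 𝒮`. [folklore] -/
theorem orbitConstOnIn_su_iff {ι S : Type*} (γ : Ends ι S) (F : (ι → M[N]) → ℂ) (𝒮 : Set (ι → M[N])) :
    OrbitConstOnIn γ (specialUnitaryUnits (Fin N)) F 𝒮 ↔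
      ∀ u : S → M[N], (∀ x, u x ∈ Matrix.specialUnitaryGroup (Fin N) ℂ) →
        ∀ V ∈ 𝒮, gaugeAct γ u V ∈ 𝒮 → F (gaugeAct γ u V) = F V := by
  constructor
  · intro h u hu V hV huV
    have hu' : ∀ x, u x ∈ unitary M[N] := fun x => (Matrix.mem_specialUnitaryGroup_iff.mp (hu x)).1
    have h' := h (fun x => ⟨u x, star (u x), Unitary.mul_star_self_of_mem (hu' x),
      Unitary.star_mul_self_of_mem (hu' x)⟩) V (fun x => hu x) hV
    rw [smul_eq_gaugeAct] at h'
    exact h' huV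
  · intro h g V hg hV hgV
    rw [smul_eq_gaugeAct] at hgV ⊢
    exact h _ (fun x => hg x) V hV hgV

/-- **(26) FOR ALL `SU(N)`-VALUED CONFIGURATIONS ⇒ (26) ON ANY SPACE OF THEM** — gen 27's hypothesis
(b13's `SiteGaugeInvSU`) implies the located one on every `𝒮 ⊆ {SU(N)-valued}`, in particular on `regSU`.
[folklore] -/
theorem orbitConstOnIn_of_siteGaugeInvSU {ι S : Type*} (γ : Ends ι S) {F : (ι → M[N]) → ℂ} (h : SiteGaugeInvSU γ F)
    {𝒮 : Set (ι → M[N])} (h𝒮 : ∀ V ∈ 𝒮, ∀ b, V b ∈ Matrix.specialUnitaryGroup (Fin N) ℂ) :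
    OrbitConstOnIn γ (specialUnitaryUnits (Fin N)) F 𝒮 :=
  (orbitConstOnIn_su_iff γ F 𝒮).mpr fun u hu V hV _ => h u hu V (h𝒮 V hV)

/-- In particular on the regular configurations of a box. [folklore] -/
theorem orbitConstOnIn_regSU_of_siteGaugeInvSU {lo hi : LSite d} {F : (BoxBond lo hi → M[N]) → ℂ}
    (h : SiteGaugeInvSU (boxEnds lo hi) F) (α' : ℝ) :
    OrbitConstOnIn (boxEnds lo hi) (specialUnitaryUnits (Fin N)) F (regSU N lo hi α') :=
  orbitConstOnIn_of_siteGaugeInvSU _ h fun _ hV => hV.1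

/-- **THE LOCATED (26) DELIVERS THE INVARIANCE AT EVERY REGULAR CONFIGURATION** for every `SU(N)`-valued `u`
(regularity is gauge invariant, §4). [cite: Balaban1985UV3, (26) p.263, p.264 («(26) holds for all regular gauge
field configurations»)] -/
theorem apply_gaugeAct_eq_of_orbitConstOnIn_regSU {lo hi : LSite d} {α' : ℝ} {F : (BoxBond lo hi → M[N]) → ℂ}
    (h26 : OrbitConstOnIn (boxEnds lo hi) (specialUnitaryUnits (Fin N)) F (regSU N lo hi α')) {u : LSite d → M[N]}
    (hu : ∀ x, u x ∈ Matrix.specialUnitaryGroup (Fin N) ℂ) {V : BoxBond lo hi → M[N]} (hV : V ∈ regSU N lo hi α') :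
    F (gaugeAct (boxEnds lo hi) u V) = F V :=
  (orbitConstOnIn_su_iff _ F _).mp h26 u hu V hV (gaugeAct_mem_regSU hu hV)

/-- **… AND THE GLOBAL CONJUGATION INVARIANCE NEAR `1`** (§2's `hconj`): with `δ = α'/4`, every `SU(N)`-valued
configuration of the box with all `‖V_b − 1‖ < δ` is regular, and so is `W·V·W⋆` (`u ≡ W`).
[cite: Balaban1985UV3, p.264 (sentence before (31)); Balaban1985Averaging, (45) p.24] -/
theorem conjInvNear_of_orbitConstOnIn_regSU {lo hi : LSite d} {α' : ℝ} {F : (BoxBond lo hi → M[N]) → ℂ}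
    (h26 : OrbitConstOnIn (boxEnds lo hi) (specialUnitaryUnits (Fin N)) F (regSU N lo hi α')) (hα' : 0 < α') :
    ∀ W ∈ Matrix.specialUnitaryGroup (Fin N) ℂ, ∀ V : BoxBond lo hi → M[N],
      (∀ b, V b ∈ Matrix.specialUnitaryGroup (Fin N) ℂ) → (∀ b, ‖V b - 1‖ < α' / 4) →
        F (fun b => W * V b * star W) = F V := by
  intro W hW V hV hδ
  have hreg : V ∈ regSU N lo hi α' :=
    mem_regSU_of_norm_sub_one_le (by positivity) (by linarith) hV fun b => (hδ b).le
  rw [← gaugeAct_const (boxEnds lo hi) (Matrix.mem_specialUnitaryGroup_iff.mp hW).1 V]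
  exact apply_gaugeAct_eq_of_orbitConstOnIn_regSU h26 (fun _ => hW) hreg

/-- The configurations of `sp′ X` — `SU(N)`-valued with (13)-type plaquette bounds `≤ α ≤ α'` inside `Λ` — are
regular. [cite: Balaban1985UV3, (13) p.259, (28) p.263 («The characteristic functions χ₁ defined in (13) give the
restrictions»)] -/
theorem mem_regSU_of_h13 {lo hi : LSite d} {α α' : ℝ} (hαα' : α ≤ α') {φ : BoxBond lo hi → M[N]}
    (hSU : ∀ b, φ b ∈ Matrix.specialUnitaryGroup (Fin N) ℂ)
    (h13 : ∀ (x : LSite d) (κ μ : Fin d), κ ≠ μ → PlaqIn lo hi (x, κ, μ) → ‖plaq (extCfg lo hi φ) x κ μ - 1‖ ≤ α) :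
    φ ∈ regSU N lo hi α' :=
  ⟨hSU, fun x κ μ hne hp => (h13 x κ μ hne hp).trans hαα'⟩

end located

/-! ## §6. THE JOINT THEOREMS ON THE BOX, `G = SU(N)`, FROM (26) ON THE REGULAR CONFIGURATIONS ONLY -/

section joint

variable (N : ℕ) [NeZero N] {d : ℕ} {lo hi : LSite d} {D : LocDomainSys}

attribute [local instance] B10Eq29TubeLine.cstarAlgebraMatrix

/-- `M_N(ℂ)`. -/
local notation "M[" N "]" => Matrix (Fin N) (Fin N) ℂ

/-- **(29) ON THE BOX FROM THE LOCATED (26)**: as gen 27's `eq29_axialBox`, with (26) assumed on the REGULAR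
`SU(N)`-valued configurations `regSU N lo hi α'` only (`α ≤ α'`): the admissible transformations are the
`SU(N)`-valued ones, the invariance at `φ ∈ sp′ X ⊆ regSU` is §5's, the datum is the (`SU(N)`-valued) axial gauge.
[cite: Balaban1985UV3, (26) p.263, p.264 («for all regular gauge field configurations»), (27)–(29) p.263] -/
theorem eq29_axialBox_reg (y : D.Dom → LSite d) (hy : ∀ X, InBox lo hi (y X)) (R : D.Dom → ℕ) {α α' : ℝ}
    (hα : 0 ≤ α) (hαα' : α ≤ α') (hR : ∀ X, (R X : ℝ) * α < 1) {E : D.Dom → (BoxBond lo hi → M[N]) → ℂ}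
    {sp' : D.Dom → Set (BoxBond lo hi → M[N])} {dep : D.Dom → Set (BoxBond lo hi)}
    (hloc : ∀ X (V V' : BoxBond lo hi → M[N]), (∀ b ∈ dep X, V b = V' b) → E X V = E X V')
    (h26 : ∀ X, OrbitConstOnIn (boxEnds lo hi) (specialUnitaryUnits (Fin N)) (E X) (regSU N lo hi α'))
    (hSU : ∀ X φ, φ ∈ sp' X → ∀ b, φ b ∈ Matrix.specialUnitaryGroup (Fin N) ℂ)
    (h13 : ∀ X φ, φ ∈ sp' X → ∀ (x : LSite d) (κ μ : Fin d), κ ≠ μ → PlaqIn lo hi (x, κ, μ) →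
      ‖plaq (extCfg lo hi φ) x κ μ - 1‖ ≤ α)
    (hdep : ∀ X, ∀ b ∈ dep X, l1 (b.1.1 - y X) ≤ R X) :
    ∀ X φ, φ ∈ sp' X → E X φ = E X (expLine (axialGenBox lo hi y R) (fun _ _ _ => 1) X φ 1) :=
  eq29_of_gaugeFix (boxEnds lo hi) (P := fun _ u => ∀ x, u x ∈ Matrix.specialUnitaryGroup (Fin N) ℂ) hloc
    (fun X φ hφ _ hu => apply_gaugeAct_eq_of_orbitConstOnIn_regSU (h26 X) hu
      (mem_regSU_of_h13 hαα' (hSU X φ hφ) (h13 X φ hφ)))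
    fun X φ hφ => ⟨_, fun x => axialFn_mem_specialUnitaryGroup N (hSU X φ hφ) (y X) x, fun b hb =>
      axial_gaugeFix_box y R (hy X) (fun b' => (Matrix.mem_specialUnitaryGroup_iff.mp (hSU X φ hφ b')).1)
        (h13 X φ hφ) hα (hR X) b (hdep X b hb)⟩

/-- **THE PRINT-FAITHFUL JOINT THEOREM, `G = SU(N)`, (26) LOCATED ON THE REGULAR CONFIGURATIONS** — gen 27's
`logHalfBound_sub_box_of_siteGaugeInvSU` with its hypothesis `h26 : ∀ X, SiteGaugeInvSU (boxEnds lo hi) (E X)`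
((26) for ALL `SU(N)`-valued configurations) REPLACED by (26) on `regSU N lo hi α'` (b13's `OrbitConstOnIn`, `H =
SU(N)`), `0 < α'`, `α ≤ α'`: (29) is `eq29_axialBox_reg`; (31)–(32) come from §2 ((26) at `u ≡ W` on the `SU(N)`-valued
configurations `α'/4`-NEAR `1`, which are regular, §4–§5) and gen 27's tracelessness; the engine and every other
binder are gen 27's BY NAME. [cite: Balaban1985UV3, (26) p.263, p.264 («(26) holds for all regular gauge field
configurations, not only for the minimal configurations U₁»), (27)–(29) p.263, (31)–(32) p.264] -/
theorem logHalfBound_sub_box_of_orbitConstOnIn_regSU {B r a p q : ℝ} (ha : 0 < a) (hp : 0 ≤ p) (hq : 0 ≤ q)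
    (hpq : 0 < p + q) (hB : 0 ≤ B) (y : D.Dom → LSite d) (hy : ∀ X, InBox lo hi (y X)) (R : D.Dom → ℕ) {α α' : ℝ}
    (hα : 0 ≤ α) (hα' : 0 < α') (hαα' : α ≤ α') (hR4 : ∀ X, (R X : ℝ) * α ≤ 1 / 4)
    (hRπ : ∀ X, (N : ℝ) * ((R X : ℝ) * α) < Real.pi) (hRpq : ∀ X, 2 * ((R X : ℝ) * α) ≤ p + q * (1 + D.dj X))
    {E : D.Dom → (BoxBond lo hi → M[N]) → ℂ} {sp' sp : D.Dom → Set (BoxBond lo hi → M[N])}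
    {dep : D.Dom → Set (BoxBond lo hi)} {nX : D.Dom → ℕ}
    (hsp : ∀ X, TubeCfg (BoxBond lo hi) M[N] a ⊆ sp X) (hE : ∀ X, DifferentiableOn ℂ (E X) (sp X))
    (h26 : ∀ X, OrbitConstOnIn (boxEnds lo hi) (specialUnitaryUnits (Fin N)) (E X) (regSU N lo hi α'))
    (hEb : B13.LogHalfBound D sp E nX B r)
    (hloc : ∀ X (V V' : BoxBond lo hi → M[N]), (∀ b ∈ dep X, V b = V' b) → E X V = E X V')
    (hSU : ∀ X φ, φ ∈ sp' X → ∀ b, φ b ∈ Matrix.specialUnitaryGroup (Fin N) ℂ)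
    (h13 : ∀ X φ, φ ∈ sp' X → ∀ (x : LSite d) (κ μ : Fin d), κ ≠ μ → PlaqIn lo hi (x, κ, μ) →
      ‖plaq (extCfg lo hi φ) x κ μ - 1‖ ≤ α)
    (hdep : ∀ X, ∀ b ∈ dep X, l1 (b.1.1 - y X) ≤ R X) :
    B13.LogHalfBound D sp' (fun X φ => E X φ - E X (fun _ => 1)) nX (8 * ((p + q) / a) ^ 2 * B) (r - 2) := by
  have hU : ∀ X φ, φ ∈ sp' X → ∀ b, φ b ∈ unitary M[N] :=
    fun X φ hφ b => (Matrix.mem_specialUnitaryGroup_iff.mp (hSU X φ hφ b)).1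
  have hgen : ∀ X φ, φ ∈ sp' X → ∀ b, axialGenBox lo hi y R X φ b ∈ skewAdjoint M[N] :=
    fun X φ hφ b => axialGenBox_mem_skewAdjoint y R (hy X) (hU X φ hφ) (h13 X φ hφ) hα (hR4 X) b
  have hbound : ∀ X φ, φ ∈ sp' X → ∀ b, ‖axialGenBox lo hi y R X φ b‖ ≤ p + q * (1 + D.dj X) :=
    fun X φ hφ b => (norm_axialGenBox_le y R (hy X) (hU X φ hφ) (h13 X φ hφ) hα
      ((hR4 X).trans (by norm_num)) b).trans (hRpq X)
  have htr : ∀ X φ, φ ∈ sp' X → ∀ b, Matrix.trace (axialGenBox lo hi y R X φ b) = 0 :=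
    fun X φ hφ b => trace_axialGenBox_eq_zero N y R (hy X) (hSU X φ hφ) (h13 X φ hφ) hα (hR4 X) (hRπ X) b
  have h0 : DerivZeroAlongV sp' E (expLine (axialGenBox lo hi y R) (fun _ _ _ => 1)) :=
    derivZeroAlongV_of_suInvariantNear N ha hsp hE (by positivity : 0 < α' / 4)
      (fun X => conjInvNear_of_orbitConstOnIn_regSU (h26 X) hα') htr
  have h29 := eq29_axialBox_reg N y hy R hα hαα' (fun X => lt_of_le_of_lt (hR4 X) (by norm_num)) hloc h26 hSU h13
    hdep
  exact logHalfBound_congr (diffAlongV_eq_sub h29)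
    (logHalfBound_expLine_of_derivZero ha hp hq hpq hB hgen (fun X φ _ b => one_mem _) hbound hsp hE h0 hEb)

/-- **GEN 27 RECOVERED**: (26) for all `SU(N)`-valued configurations (`SiteGaugeInvSU`) implies the located
hypothesis for every `α'` (§5), so gen 27's `logHalfBound_sub_box_of_siteGaugeInvSU` is the case `α' = α + 1` of
`logHalfBound_sub_box_of_orbitConstOnIn_regSU`. [folklore] -/
example {B r a p q : ℝ} (ha : 0 < a) (hp : 0 ≤ p) (hq : 0 ≤ q)
    (hpq : 0 < p + q) (hB : 0 ≤ B) (y : D.Dom → LSite d) (hy : ∀ X, InBox lo hi (y X)) (R : D.Dom → ℕ) {α : ℝ}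
    (hα : 0 ≤ α) (hR4 : ∀ X, (R X : ℝ) * α ≤ 1 / 4) (hRπ : ∀ X, (N : ℝ) * ((R X : ℝ) * α) < Real.pi)
    (hRpq : ∀ X, 2 * ((R X : ℝ) * α) ≤ p + q * (1 + D.dj X)) {E : D.Dom → (BoxBond lo hi → M[N]) → ℂ}
    {sp' sp : D.Dom → Set (BoxBond lo hi → M[N])} {dep : D.Dom → Set (BoxBond lo hi)} {nX : D.Dom → ℕ}
    (hsp : ∀ X, TubeCfg (BoxBond lo hi) M[N] a ⊆ sp X) (hE : ∀ X, DifferentiableOn ℂ (E X) (sp X))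
    (h26 : ∀ X, SiteGaugeInvSU (boxEnds lo hi) (E X)) (hEb : B13.LogHalfBound D sp E nX B r)
    (hloc : ∀ X (V V' : BoxBond lo hi → M[N]), (∀ b ∈ dep X, V b = V' b) → E X V = E X V')
    (hSU : ∀ X φ, φ ∈ sp' X → ∀ b, φ b ∈ Matrix.specialUnitaryGroup (Fin N) ℂ)
    (h13 : ∀ X φ, φ ∈ sp' X → ∀ (x : LSite d) (κ μ : Fin d), κ ≠ μ → PlaqIn lo hi (x, κ, μ) →
      ‖plaq (extCfg lo hi φ) x κ μ - 1‖ ≤ α)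
    (hdep : ∀ X, ∀ b ∈ dep X, l1 (b.1.1 - y X) ≤ R X) :
    B13.LogHalfBound D sp' (fun X φ => E X φ - E X (fun _ => 1)) nX (8 * ((p + q) / a) ^ 2 * B) (r - 2) :=
  logHalfBound_sub_box_of_orbitConstOnIn_regSU N ha hp hq hpq hB y hy R hα (by linarith : 0 < α + 1) (by linarith)
    hR4 hRπ hRpq hsp hE (fun X => orbitConstOnIn_regSU_of_siteGaugeInvSU (h26 X) (α + 1)) hEb hloc hSU h13 hdep

/-- Sanity: the same statement from gen 27 BY NAME (the binder lists agree except for `h26` ↦ located `h26`, `0 <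
α′`, `α ≤ α′`). [folklore] -/
example {B r a p q : ℝ} (ha : 0 < a) (hp : 0 ≤ p) (hq : 0 ≤ q)
    (hpq : 0 < p + q) (hB : 0 ≤ B) (y : D.Dom → LSite d) (hy : ∀ X, InBox lo hi (y X)) (R : D.Dom → ℕ) {α : ℝ}
    (hα : 0 ≤ α) (hR4 : ∀ X, (R X : ℝ) * α ≤ 1 / 4) (hRπ : ∀ X, (N : ℝ) * ((R X : ℝ) * α) < Real.pi)
    (hRpq : ∀ X, 2 * ((R X : ℝ) * α) ≤ p + q * (1 + D.dj X)) {E : D.Dom → (BoxBond lo hi → M[N]) → ℂ}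
    {sp' sp : D.Dom → Set (BoxBond lo hi → M[N])} {dep : D.Dom → Set (BoxBond lo hi)} {nX : D.Dom → ℕ}
    (hsp : ∀ X, TubeCfg (BoxBond lo hi) M[N] a ⊆ sp X) (hE : ∀ X, DifferentiableOn ℂ (E X) (sp X))
    (h26 : ∀ X, SiteGaugeInvSU (boxEnds lo hi) (E X)) (hEb : B13.LogHalfBound D sp E nX B r)
    (hloc : ∀ X (V V' : BoxBond lo hi → M[N]), (∀ b ∈ dep X, V b = V' b) → E X V = E X V')
    (hSU : ∀ X φ, φ ∈ sp' X → ∀ b, φ b ∈ Matrix.specialUnitaryGroup (Fin N) ℂ)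
    (h13 : ∀ X φ, φ ∈ sp' X → ∀ (x : LSite d) (κ μ : Fin d), κ ≠ μ → PlaqIn lo hi (x, κ, μ) →
      ‖plaq (extCfg lo hi φ) x κ μ - 1‖ ≤ α)
    (hdep : ∀ X, ∀ b ∈ dep X, l1 (b.1.1 - y X) ≤ R X) :
    B13.LogHalfBound D sp' (fun X φ => E X φ - E X (fun _ => 1)) nX (8 * ((p + q) / a) ^ 2 * B) (r - 2) :=
  logHalfBound_sub_box_of_siteGaugeInvSU N ha hp hq hpq hB y hy R hα hR4 hRπ hRpq hsp hE h26 hEb hloc hSU h13 hdep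

end joint

/-! ## §7. TOYS: `htr` CANNOT BE DROPPED (the bond determinant); the located (26) is strictly weaker than the
## global one at the level of the bare predicates (a center twist on the unit square of `ℤ²`) -/

section toys

variable (N : ℕ) [NeZero N]

attribute [local instance] B10Eq29TubeLine.cstarAlgebraMatrix

/-- `M_N(ℂ)`. -/
local notation "M[" N "]" => Matrix (Fin N) (Fin N) ℂ

omit [NeZero N] in
/-- The bond determinant `E(𝐕) = det V_{b₀}` is invariant under the global conjugations by `SU(N)` at EVERY
configuration (indeed under all `SU(N)`-valued site transformations, b13's `siteGaugeInvSU_det`) — so it satisfies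
§2's `hconj` for every `δ` and gen 27's global `hconj`. [folklore] -/
theorem toyDet_conj {ι : Type*} (b₀ : ι) {W : M[N]} (hW : W ∈ Matrix.specialUnitaryGroup (Fin N) ℂ) (V : ι → M[N]) :
    (fun V : ι → M[N] => (V b₀).det) (fun b => W * V b * star W) = (V b₀).det := by
  have hd : W.det = 1 := (Matrix.mem_specialUnitaryGroup_iff.mp hW).2
  simp only [Matrix.det_mul, Matrix.star_eq_conjTranspose, Matrix.det_conjTranspose, hd, star_one, one_mul, mul_one]

omit [NeZero N] in
/-- … and is holomorphic everywhere (so §2's `hsp`, `hE` hold with `sp X =` everything). [folklore] -/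
theorem toyDet_differentiableOn {ι : Type*} [Fintype ι] (b₀ : ι) (s : Set (ι → M[N])) :
    DifferentiableOn ℂ (fun V : ι → M[N] => (V b₀).det) s :=
  (differentiable_det.comp (differentiable_apply b₀)).differentiableOn

omit [NeZero N] in
/-- The scalar generator `i·1` is skew-Hermitian (an element of `𝔲(N)`) with trace `i·N` (NOT in `𝔰𝔲(N)`). [folklore] -/
theorem toyGen_skew_trace : star (Complex.I • (1 : M[N])) = -(Complex.I • (1 : M[N])) ∧
    Matrix.trace (Complex.I • (1 : M[N])) = Complex.I * N := by
  refine ⟨?_, ?_⟩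
  · rw [star_smul, star_one, Complex.star_def, Complex.conj_I, neg_smul]
  · rw [Matrix.trace_smul, Matrix.trace_one, Fintype.card_fin, smul_eq_mul]

/-- **TIGHTNESS OF `htr` IN §2 / GEN 27 §4**: along the scalar generator `i·1` (skew-Hermitian, trace `i·N ≠ 0`) the
bond determinant — `SU(N)`-conjugation invariant everywhere, holomorphic everywhere — has `d/dζ det(exp(ζ·i·1)·1)|₀ =
i·N ≠ 0`: (32) FAILS, so the tracelessness hypothesis `htr` of `derivZeroAlongV_of_suInvariantNear` /
`derivZeroAlongV_of_fderivConjInvariant` / gen 27's `derivZeroAlongV_of_suInvariant` cannot be dropped (print p. 264: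
«by the assumption that 𝔤 is semi-simple, the only element invariant is 0» — for `𝔲(N) ∋ i·1` it is not).
[cite: Balaban1985UV3, (32) p.264, p.264 («It is the only place we use the semi-simplicity»)] -/
theorem not_derivZeroAlongV_toyDet {ι : Type*} [Fintype ι] (b₀ : ι) {D : LocDomainSys} (X₀ : D.Dom) :
    ¬ DerivZeroAlongV (fun _ : D.Dom => (Set.univ : Set (ι → M[N]))) (fun _ V => (V b₀).det)
        (expLine (fun _ _ _ => Complex.I • (1 : M[N])) (fun _ _ _ => 1)) := by
  intro h
  have h0 := h X₀ (fun _ => 1) (Set.mem_univ _)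
  have hfun : (fun ζ : ℂ => (expLine (D := D) (fun _ _ _ => Complex.I • (1 : M[N])) (fun _ _ _ => 1) X₀
      (fun _ => (1 : M[N])) ζ b₀).det) = fun ζ : ℂ => Complex.exp (ζ * (Complex.I * N)) := by
    funext ζ
    simp only [expLine, mul_one]
    rw [det_exp, Matrix.trace_smul, (toyGen_skew_trace N).2, smul_eq_mul]
  rw [hfun] at h0
  have hd : HasDerivAt (fun ζ : ℂ => Complex.exp (ζ * (Complex.I * N))) (Complex.I * N) 0 := by
    have h1 := ((hasDerivAt_id (0 : ℂ)).mul_const (Complex.I * N)).cexp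
    simpa using h1
  rw [hd.deriv] at h0
  exact mul_ne_zero Complex.I_ne_zero (Nat.cast_ne_zero.mpr (NeZero.ne N)) h0


/-! ### §7b. The located (26) is STRICTLY WEAKER than the global one (bare predicates; unit square of `ℤ²`) -/

omit [NeZero N] in
/-- `(Vᵘ)^{u⋆} = V` for unitary-valued site transformations `u` (the site gauge ACTION). [folklore] -/
theorem gaugeAct_star_gaugeAct {ι S : Type*} (γ : Ends ι S) {u : S → M[N]} (hu : ∀ x, u x ∈ unitary M[N])
    (V : ι → M[N]) : gaugeAct γ (fun x => star (u x)) (gaugeAct γ u V) = V := by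
  rw [gaugeAct_eq_star γ hu, gaugeAct_eq_star γ fun x => Unitary.star_mem (hu x)]
  funext b
  simp only [star_star]
  rw [show star (u (γ.src b)) * (u (γ.src b) * V b * star (u (γ.tgt b))) * u (γ.tgt b) =
      (star (u (γ.src b)) * u (γ.src b)) * V b * (star (u (γ.tgt b)) * u (γ.tgt b)) by noncomm_ring,
    Unitary.star_mul_self_of_mem (hu _), Unitary.star_mul_self_of_mem (hu _), one_mul, mul_one]

omit [NeZero N] in
/-- Non-regularity is gauge invariant too (§4 applied to `u⋆`). [folklore] -/
theorem not_mem_regSU_gaugeAct {d : ℕ} {lo hi : LSite d} {α' : ℝ} {u : LSite d → M[N]}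
    (hu : ∀ x, u x ∈ Matrix.specialUnitaryGroup (Fin N) ℂ) {V : BoxBond lo hi → M[N]} (hV : V ∉ regSU N lo hi α') :
    gaugeAct (boxEnds lo hi) u V ∉ regSU N lo hi α' := by
  intro h
  have h' := gaugeAct_mem_regSU (u := fun x => star (u x)) (fun x => star_mem_specialUnitaryGroup (hu x)) h
  rw [gaugeAct_star_gaugeAct N _ (fun x => (Matrix.mem_specialUnitaryGroup_iff.mp (hu x)).1)] at h'
  exact hV h'

/-- `0 ∈ [0, 1]²`. [folklore] -/
theorem inBox_sq_zero : InBox (0 : LSite 2) 1 0 := fun i => by simp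

/-- `e_κ ∈ [0, 1]²`. [folklore] -/
theorem inBox_sq_e (κ : Fin 2) : InBox (0 : LSite 2) 1 (0 + e κ) := fun i => by
  rw [add_e_apply]; split_ifs <;> simp

/-- `e₀ + e₁ ∈ [0, 1]²`. [folklore] -/
theorem inBox_sq_ee : InBox (0 : LSite 2) 1 (0 + e 0 + e 1) := fun i => by
  rw [add_e_apply, add_e_apply]
  fin_cases i <;> simp

/-- The bond `b₀ = ⟨0, e₀⟩` of the unit square `[0, 1]² ⊂ ℤ²`. [folklore] -/
def sqBond : BoxBond (0 : LSite 2) 1 := ⟨((0 : LSite 2), (0 : Fin 2)), inBox_sq_zero, inBox_sq_e 0⟩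

/-- **THE CENTER TWIST**: the configuration of the unit square carrying b07's central element `Z = e^{2πi/N}·1 ∈
SU(N)` on `b₀ = ⟨0, e₀⟩` and `1` on the other three bonds; its one plaquette variable is `Z`. [folklore] -/
noncomputable def twistV : BoxBond (0 : LSite 2) 1 → M[N] :=
  fun b => if (b : LSite 2 × Fin 2) = ((0 : LSite 2), (0 : Fin 2)) then (ZU N : M[N]) else 1

/-- The site transformation `u₀(0) = Z⋆`, `u₀ ≡ 1` elsewhere (`SU(N)`-valued): it untwists `b₀`. [folklore] -/
noncomputable def untwist : LSite 2 → M[N] := fun x => if x = 0 then star (ZU N : M[N]) else 1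

/-- `Z ∈ SU(N)` (b07's `ZU_mem`, at value level). [folklore] -/
theorem val_ZU_mem : (ZU N : M[N]) ∈ Matrix.specialUnitaryGroup (Fin N) ℂ := mem_specialUnitaryUnits.mp (ZU_mem N)

/-- The twist is `SU(N)`-valued. [folklore] -/
theorem twistV_mem (b : BoxBond (0 : LSite 2) 1) : twistV N b ∈ Matrix.specialUnitaryGroup (Fin N) ℂ := by
  unfold twistV
  split_ifs
  exacts [val_ZU_mem N, one_mem _]

/-- The untwisting transformation is `SU(N)`-valued. [folklore] -/
theorem untwist_mem (x : LSite 2) : untwist N x ∈ Matrix.specialUnitaryGroup (Fin N) ℂ := by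
  unfold untwist
  split_ifs
  exacts [star_mem_specialUnitaryGroup (val_ZU_mem N), one_mem _]

omit [NeZero N] in
/-- `twistV(b₀) = Z`. [folklore] -/
theorem twistV_sqBond : twistV N sqBond = (ZU N : M[N]) := if_pos rfl

omit [NeZero N] in
/-- The extension-by-`1` of the twist: `Z` on `b₀`, `1` on every other bond of `ℤ²`. [folklore] -/
theorem extCfg_twistV (b : LSite 2 × Fin 2) :
    extCfg 0 1 (twistV N) b = if b = ((0 : LSite 2), (0 : Fin 2)) then (ZU N : M[N]) else 1 := by
  by_cases hb : InBox (0 : LSite 2) 1 b.1 ∧ InBox (0 : LSite 2) 1 (b.1 + e b.2)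
  · exact extCfg_coe (twistV N) ⟨b, hb⟩
  · rw [extCfg_of_not _ hb, if_neg]
    rintro rfl
    exact hb ⟨inBox_sq_zero, inBox_sq_e 0⟩

omit [NeZero N] in
/-- The plaquette variable of the unit square in the twist is `Z`. [folklore] -/
theorem plaq_twistV : plaq (extCfg 0 1 (twistV N)) 0 0 1 = (ZU N : M[N]) := by
  have h01 : ((0 : LSite 2) + e 0, (1 : Fin 2)) ≠ ((0 : LSite 2), (0 : Fin 2)) := fun h =>
    absurd (congrArg Prod.snd h) (by decide)
  have h10 : ((0 : LSite 2) + e 1, (0 : Fin 2)) ≠ ((0 : LSite 2), (0 : Fin 2)) := fun h => by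
    have h' := congrArg (fun q : LSite 2 × Fin 2 => q.1 1) h
    simp [e_apply] at h'
  have h1 : ((0 : LSite 2), (1 : Fin 2)) ≠ ((0 : LSite 2), (0 : Fin 2)) := fun h =>
    absurd (congrArg Prod.snd h) (by decide)
  rw [plaq, extCfg_twistV, extCfg_twistV, extCfg_twistV, extCfg_twistV, if_pos rfl, if_neg h01, if_neg h10,
    if_neg h1, star_one, mul_one, mul_one, mul_one]

/-- `‖Z − 1‖ = |e^{2πi/N} − 1|`. [folklore] -/
theorem norm_val_ZU_sub_one : ‖(ZU N : M[N]) - 1‖ = ‖Complex.exp (thetaN N) - 1‖ := by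
  rw [val_ZU, show Complex.exp (thetaN N) • (1 : M[N]) - 1 = (Complex.exp (thetaN N) - 1) • (1 : M[N]) by
    rw [sub_smul, one_smul], norm_smul, CStarRing.norm_one, mul_one]

/-- So the twist is NOT regular once `α′ < |e^{2πi/N} − 1|`. [folklore] -/
theorem twistV_not_mem_regSU {α' : ℝ} (hα' : α' < ‖Complex.exp (thetaN N) - 1‖) :
    twistV N ∉ regSU N (0 : LSite 2) 1 α' := by
  intro h
  have h' := h.2 0 0 1 (by decide) ⟨inBox_sq_zero, inBox_sq_ee⟩
  rw [plaq_twistV, norm_val_ZU_sub_one] at h'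
  linarith

/-- Untwisting: `(twistV)^{u₀}(b₀) = Z⋆·Z·1 = 1`. [folklore] -/
theorem gaugeAct_untwist_twistV_sqBond : gaugeAct (boxEnds 0 1) (untwist N) (twistV N) sqBond = 1 := by
  have hu : ∀ x, untwist N x ∈ unitary M[N] := fun x => (Matrix.mem_specialUnitaryGroup_iff.mp (untwist_mem N x)).1
  have hne : (0 : LSite 2) + e 0 ≠ 0 := fun h => by
    have h' := congrArg (fun x : LSite 2 => x 0) h
    simp [e_apply] at h'
  have hu0 : untwist N 0 = star (ZU N : M[N]) := if_pos rfl
  have hu1 : untwist N (0 + e 0) = 1 := if_neg hne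
  rw [gaugeAct_eq_star _ hu]
  show untwist N 0 * twistV N sqBond * star (untwist N (0 + e 0)) = 1
  rw [twistV_sqBond, hu0, hu1, star_one, mul_one]
  exact Unitary.star_mul_self_of_mem (Matrix.mem_specialUnitaryGroup_iff.mp (val_ZU_mem N)).1

omit [NeZero N] in
/-- The threshold is positive for `N ≥ 2` (`e^{2πi/N} ≠ 1`), so the witness below covers every `0 ≤ α′ <
|e^{2πi/N} − 1|`, in particular all small `α′ ≥ 0` (print's regime). [folklore] -/
theorem norm_exp_thetaN_sub_one_pos (hN : 2 ≤ N) : 0 < ‖Complex.exp (thetaN N) - 1‖ := by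
  rw [norm_pos_iff, sub_ne_zero]
  intro h
  have hre := congrArg Complex.re h
  rw [thetaN, Complex.exp_ofReal_mul_I_re, Complex.one_re] at hre
  have hN' : (2 : ℝ) ≤ N := by exact_mod_cast hN
  have hpos : 0 < 2 * Real.pi / N := by positivity
  have hlt : 2 * Real.pi / N < 2 * Real.pi := by
    rw [div_lt_iff₀ (by positivity)]
    nlinarith [Real.pi_pos]
  have h0 := (Real.cos_eq_one_iff_of_lt_of_lt (by linarith) hlt).mp hre
  linarith

/-- **THE LOCATED (26) IS STRICTLY WEAKER THAN THE GLOBAL ONE** (bare predicates, `0 ≤ α′ < |e^{2πi/N} − 1|`, unit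
square `[0, 1]² ⊂ ℤ²`): the function `F = 0` on `regSU`, `F(V) = ‖V(b₀) − 1‖` off it, is orbit-constant on `regSU`
relative to the `SU(N)`-valued site transformations (trivially: `regSU` is stable, §4) but NOT `SiteGaugeInvSU`: the
center twist (plaquette variable `Z`, not regular) has `F = ‖Z − 1‖ ≠ 0`, and untwisting it by `u₀` (which stays off
`regSU`) gives `F = 0`.  So gen 27's hypothesis `SiteGaugeInvSU` is strictly stronger than this module's `h26` —
at the level of the predicates; see HONEST SCOPE (v). [folklore] -/
theorem located26_strictly_weaker {α' : ℝ} (h0 : 0 ≤ α') (hα' : α' < ‖Complex.exp (thetaN N) - 1‖) :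
    ∃ F : (BoxBond (0 : LSite 2) 1 → M[N]) → ℂ,
      OrbitConstOnIn (boxEnds 0 1) (specialUnitaryUnits (Fin N)) F (regSU N 0 1 α') ∧
        ¬ SiteGaugeInvSU (boxEnds 0 1) F := by
  classical
  refine ⟨fun V => if V ∈ regSU N (0 : LSite 2) 1 α' then 0 else (‖V sqBond - 1‖ : ℂ), ?_, ?_⟩
  · exact (orbitConstOnIn_su_iff _ _ _).mpr fun u _ V hV huV => by simp only [if_pos hV, if_pos huV]
  · intro h
    have h1 := h (untwist N) (untwist_mem N) (twistV N) (twistV_mem N)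
    have hV : twistV N ∉ regSU N (0 : LSite 2) 1 α' := twistV_not_mem_regSU N hα'
    have huV : gaugeAct (boxEnds 0 1) (untwist N) (twistV N) ∉ regSU N (0 : LSite 2) 1 α' :=
      not_mem_regSU_gaugeAct N (untwist_mem N) hV
    simp only [if_neg hV, if_neg huV, gaugeAct_untwist_twistV_sqBond, twistV_sqBond, sub_self, norm_zero,
      Complex.ofReal_zero, norm_val_ZU_sub_one] at h1
    have hne : (‖Complex.exp (thetaN N) - 1‖ : ℂ) ≠ 0 :=
      Complex.ofReal_ne_zero.mpr (h0.trans_lt hα').ne'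
    exact hne h1.symm

end toys

end Literature.MathematicalPhysics.QuantumFieldTheory.Balaban1983to89.B10Eq32RegularSuN
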